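import Summits.Ventures.QEC.Thresholds.ToricCodeThresholdKernelSymm
import Literature.Probability.RandomPlanarGeometry.SAWFiniteMemoryZ3KernelSymmK12
import HarnessLib

/-!
# Phenomenological toric-code threshold from the KERNEL-checked SYMMETRY-REDUCED memory-12 bound `μ(ℤ³) ≤ 4.7476`:
# `p_c > .0112` (noisy measurement, `q = p`) — unconditional, tier CERTIFIED (kernel)

Venture QEC, `Summits/Ventures/QEC/Thresholds/` (continues `ToricCodeThresholdKernelSymm.lean`; LADDER item 03.PTMEM, rung 2). Input, axioms
`propext`/`Classical.choice`/`Quot.sound`: `SAW.Zd.FiniteMemory3.connectiveConstant_three_le_47476` (`SAWFiniteMemoryZ3KernelSymmK12.lean`: the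
symmetry-reduced 6-ary trie certificate of the memory-12 automaton of `ℤ³` — `46 562` orbit representatives of its `2 189 077` states under the
48 lattice symmetries — checked by `decide +kernel`; Pönitz–Tittmann 2000, Table 2, `d = 3, k = 12`: `4.7476`). Through the unconditional
parametric theorem `phenomThreshold_connectiveConstant_three_le` (the DKLP space-time polygon route):

| theorem | statement | tier |
|---|---|---|
| `phenomThreshold_kernelZ3SymmK12` | threshold `≥ p₀(4.7476)` for every poly-bounded schedule and every min-weight space-time decoder family | CERTIFIED (kernel), unconditional |
| `thresholdValue_47476_bounds` | `.0112 < p₀(4.7476) < .0113` | kernel arithmetic |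
| `phenom_accuracyThreshold_gt_0112`, `ToricCode.phenom_accuracyThreshold_stMinWeight_gt_0112`, `phenom_decaysExponentially_0112` | **`p_c > .0112`** (kernel decimals so far `.0101 → .0106 → .0109 → .0110 → .0111`) | CERTIFIED (kernel), unconditional |

With this the KERNEL decimal EQUALS the CONDITIONAL one (`.0112`, which the tree states under the hypothesis of Pönitz–Tittmann's `k = 14` value
`μ(ℤ³) ≤ 4.7387`): the phenomenological column of LADDER rung Q5 no longer depends on an unproved connective-constant fact at four decimals.
NOT A THEOREM ANYWHERE: DKLP's printed `.0114` (numerical `μ(ℤ³)`, CLAIM). Theorem-only file.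

## References

* [DennisEtAl2002] E. Dennis, A. Kitaev, A. Landahl, J. Preskill, J. Math. Phys. 43 (2002) 4452,
  arXiv:quant-ph/0110143, §5.3 eqs. (saw_3), (threshold_iso_num), (fail_iso).
* [PonitzTittmann2000] A. Pönitz, P. Tittmann, Electron. J. Combin. 7 (2000) R21, §3 and Table 2 (`d = 3, k = 12`: `4.7476`).
-/

noncomputable section

namespace Summit.Ventures.QEC.Thresholds

open Filter Topology Finset
open Literature.InformationTheory.QuantumCodes
open Literature.InformationTheory.QuantumCodes.ToricCode
open Literature.Probability.RandomPlanarGeometry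

/-! ### Noisy syndrome measurement (`q = p`): `p_c > .0112` -/

/-- **Phenomenological toric threshold `≥ p₀(4.7476)`, UNCONDITIONAL, tier CERTIFIED (kernel)**, for every polynomially
bounded schedule of rounds and every minimum-weight space-time decoder family, from the kernel-checked symmetry-reduced
memory-12 bound `μ(ℤ³) ≤ 4.7476`. [cite: DennisEtAl2002, §5.3 eqs. (saw_3), (threshold_iso_num)] -/
theorem phenomThreshold_kernelZ3SymmK12 {T : ℕ → ℕ} (hT : IsPolyBounded T)
    {D : (L : ℕ) → STDecoder (L + 1) (T L)}
    (hD : ∀ L, (D L).IsMinWeight (stSyn (L + 1) (T L)) (stCycles (L + 1) (T L)) hammingNorm) :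
    IsThresholdLowerBound (phenomFailureFamily T D) (thresholdValue 4.7476) :=
  phenomThreshold_connectiveConstant_three_le (by norm_num)
    SAW.Zd.FiniteMemory3.connectiveConstant_three_le_47476 hT hD

/-- Decimal certificate: `.0112 < p₀(4.7476) < .0113`. [cite: DennisEtAl2002, §5.3 eq. (threshold_iso_num)] -/
theorem thresholdValue_47476_bounds :
    (0.0112 : ℝ) < thresholdValue 4.7476 ∧ thresholdValue 4.7476 < 0.0113 := by
  unfold thresholdValue
  constructor
  · have : Real.sqrt (1 - 1 / (4.7476 : ℝ) ^ 2) < 0.9776 := by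
      rw [Real.sqrt_lt' (by norm_num)]
      norm_num
    linarith
  · have : (0.9774 : ℝ) < Real.sqrt (1 - 1 / (4.7476 : ℝ) ^ 2) := by
      rw [Real.lt_sqrt (by norm_num)]
      norm_num
    linarith

/-- **`p_c > .0112`** under phenomenological noise (`q = p`) for every minimum-weight space-time decoder family and every
polynomially bounded schedule — UNCONDITIONAL, tier CERTIFIED (kernel); the tree's earlier `.0112` statements
(`phenom_accuracyThreshold_gt_PT2000_of_fact` & co.) carry the Pönitz–Tittmann `k = 14` value as a HYPOTHESIS — this one has none. [cite: DennisEtAl2002, §5.3 eq. (threshold_iso_num)] -/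
theorem phenom_accuracyThreshold_gt_0112 {T : ℕ → ℕ} (hT : IsPolyBounded T)
    {D : (L : ℕ) → STDecoder (L + 1) (T L)}
    (hD : ∀ L, (D L).IsMinWeight (stSyn (L + 1) (T L)) (stCycles (L + 1) (T L)) hammingNorm) :
    (0.0112 : ℝ) < accuracyThreshold (phenomFailureFamily T D) :=
  lt_of_lt_of_le thresholdValue_47476_bounds.1
    (le_accuracyThreshold (phenomThreshold_kernelZ3SymmK12 hT hD) ((thresholdValue_le_half _).trans (by norm_num)))

/-- The canonical instance (`T(L) = L + 1` rounds, canonical minimum-weight space-time decoders): `p_c > .0112` —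
UNCONDITIONAL, kernel.
[cite: DennisEtAl2002, §5.3 eq. (threshold_iso_num)] -/
theorem ToricCode.phenom_accuracyThreshold_stMinWeight_gt_0112 :
    (0.0112 : ℝ) < accuracyThreshold
      (phenomFailureFamily (fun L => L + 1) fun L => Decoder.minWeight (stSyn (L + 1) (L + 1)) hammingNorm) :=
  phenom_accuracyThreshold_gt_0112 isPolyBounded_succ fun L => ToricCode.isMinWeight_stMinWeight (L + 1) (L + 1)

/-- **Exponential decay at every `0 ≤ p ≤ .0112`** under phenomenological noise, UNCONDITIONAL, kernel (cubic walk-count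
constant at `ν = 4.75 > μ(ℤ³)`; `.0112 < p₀(4.75)`). [cite: DennisEtAl2002, §5.3 eq. (fail_iso)] -/
theorem phenom_decaysExponentially_0112 {T : ℕ → ℕ} (hT : IsPolyBounded T)
    {D : (L : ℕ) → STDecoder (L + 1) (T L)}
    (hD : ∀ L, (D L).IsMinWeight (stSyn (L + 1) (T L)) (stCycles (L + 1) (T L)) hammingNorm)
    {p : ℝ} (hp₀ : 0 ≤ p) (hpp : p ≤ 0.0112) :
    DecaysExponentially (phenomFailureFamily T D) p := by
  have hlt : SAW.Zd.connectiveConstant 3 < 4.75 :=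
    lt_of_le_of_lt SAW.Zd.FiniteMemory3.connectiveConstant_three_le_47476 (by norm_num)
  obtain ⟨C, hC⟩ := exists_sawCountBound3_of_connectiveConstant_lt hlt
  have hval : (0.0112 : ℝ) < thresholdValue 4.75 := by
    unfold thresholdValue
    have : Real.sqrt (1 - 1 / (4.75 : ℝ) ^ 2) < 0.9776 := by
      rw [Real.sqrt_lt' (by norm_num)]
      norm_num
    linarith
  exact phenom_decaysExponentially_sawCountBound3' (by norm_num) hC hT hD hp₀ (lt_of_le_of_lt hpp hval)

end Summit.Ventures.QEC.Thresholds
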